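import Literature.ModelTheory.ExponentialFields.MacintyreWilkieConditionalHalf
import Literature.ModelTheory.ExponentialFields.DesingularisationProofs
import HarnessLib

/-!
# The conditional half of Macintyre–Wilkie's theorem — discharged

Family `periods` (periods.S27), topic `Literature/ModelTheory/ExponentialFields`.  With Wilkie's
desingularisation for flat exponential polynomials proved
(`Wilkie1996_flatDesingularisation_holds`, `DesingularisationProofs.lean`), every leaf of the
decomposition of the **conditional half** of Macintyre–Wilkie's Theorem 1.1
(`MacintyreWilkieConditionalHalf.lean`: (B2) desingularisation, (B3) Jones–Servi's generators of
the point ideal, (B4) the r.e. Newton scheme, on top of the Newton transfer, the reduction of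
existential sentences to flat equations and the r.e. bookkeeping) is a theorem of the tree, so the
named fact

* `Literature.ModelTheory.ExponentialFields.macintyreWilkie_existential_of_schanuelProperty`
  (`MacintyreWilkie.lean`): *if the real exponential field has the Schanuel property, then the
  existential theory `Th_∃(ℝ_exp)` is computably axiomatizable (equivalently r.e.)*

is **discharged** here (`macintyreWilkie_existential_of_schanuelProperty_holds`), together with
its working forms: under `SC_ℝ` the true recursive-plus-r.e. theory
`mwTheory = OEF ∪ NewtonScheme` proves every true existential sentence of `ℝ_exp`
(`mwTheory_models_of_mem_of_schanuelProperty`), `Th_∃(ℝ_exp)` is r.e.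
(`realExpExistentialTheory_isREAxioms_of_schanuelProperty`), and some *recursive* set of true
sentences proves it (`exists_isRecursive_models_realExpExistentialTheory_of_schanuelProperty`,
Craig).

Consequently Macintyre–Wilkie's Theorem 1.1 itself,
`macintyre_wilkie : SchanuelProperty ℝ → RealExpDecidable`, now rests on **one** named fact only,
the unconditional half in the form their proof provides it — the recursive subtheory
`macintyreWilkie_recursiveSubtheory` (`T₀ ⊆ Th(ℝ_exp)` recursive with
`T₀ ∪ Th_∃(ℝ_exp) ⊨ Th(ℝ_exp)`, i.e. Wilkie's model completeness made effective):
`macintyre_wilkie_of_recursiveSubtheory_alone`.  That fact is a theory in itself and is not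
attempted here.

## References

* A. Macintyre, A. J. Wilkie, *On the decidability of the real exponential field*, in:
  Kreiseliana: About and Around Georg Kreisel, A K Peters (1996), 441–467, Thm. 1.1 and §5.
* G. O. Jones, T. Servi, *On the decidability of the real field with a generic power function*,
  J. Symb. Log. 76 (2011), §3 (Prop. 3.8, Thm. 3.11).
* M. Carl, L. S. Krapp, *Models of true arithmetic are integer parts of models of real
  exponentiation*, J. Log. Anal. 13:3 (2021), p. 10.
-/

noncomputable section

open FirstOrder FirstOrder.Language

namespace Literature.ModelTheory.ExponentialFields

/-- **`OEF ∪ NewtonScheme` proves every true existential sentence of `ℝ_exp` under the real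
Schanuel property** — `mwTheory_models_of_mem` with its two named-fact hypotheses discharged
(`Wilkie1996_flatDesingularisation_holds`, `JonesServi2011_pointIdealGenerators_holds`). [cite: MacintyreWilkieKreiseliana1996, Thm. 1.1 (conditional half), §5] -/
theorem mwTheory_models_of_mem_of_schanuelProperty (hSC : SchanuelProperty ℝ)
    {φ : Language.orderedExpRing.Sentence} (hφ : φ ∈ realExpExistentialTheory) : mwTheory ⊨ᵇ φ :=
  mwTheory_models_of_mem Wilkie1996_flatDesingularisation_holds JonesServi2011_pointIdealGenerators_holds
    hSC hφ

/-- **`Th_∃(ℝ_exp)` is recursively enumerable under the real Schanuel property** (all leaves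
discharged). [cite: MacintyreWilkieKreiseliana1996, Thm. 1.1 (conditional half), §5] -/
theorem realExpExistentialTheory_isREAxioms_of_schanuelProperty (hSC : SchanuelProperty ℝ) :
    realExpExistentialTheory.IsREAxioms :=
  realExpExistentialTheory_isREAxioms_of_leaves Wilkie1996_flatDesingularisation_holds
    JonesServi2011_pointIdealGenerators_holds ExpPolyCode.newtonScheme_isREAxioms hSC

/-- **The conditional half of Macintyre–Wilkie's Theorem 1.1, discharged**: if the real
exponential field has the Schanuel property, then `Th_∃(ℝ_exp)` is computably axiomatizable.
Proof: `macintyreWilkie_existential_of_desingularisation` (Macintyre–Wilkie §5 in the rendering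
of Jones–Servi 2011 §3, assembled in `MacintyreWilkieConditionalHalf.lean`) applied to
`Wilkie1996_flatDesingularisation_holds`. [cite: MacintyreWilkieKreiseliana1996, Thm. 1.1 (conditional half), §5] -/
theorem macintyreWilkie_existential_of_schanuelProperty_holds :
    macintyreWilkie_existential_of_schanuelProperty :=
  macintyreWilkie_existential_of_desingularisation Wilkie1996_flatDesingularisation_holds

/-- Under the real Schanuel property, `Th_∃(ℝ_exp)` is a *recursive*ly axiomatized fragment:
some recursive set of sentences true in `ℝ_exp` proves every true existential sentence (Craig's
trick applied to `OEF ∪ NewtonScheme`). This is the hypothesis `h₁` of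
`macintyre_wilkie_of_recursiveSubtheory_of_existential_consequences`. [folklore] -/
theorem exists_isRecursive_models_realExpExistentialTheory_of_schanuelProperty
    (hSC : SchanuelProperty ℝ) :
    ∃ T₁ : Language.orderedExpRing.Theory, T₁ ⊆ realExpTheory ∧ T₁.IsRecursive ∧
      ∀ φ ∈ realExpExistentialTheory, T₁ ⊨ᵇ φ :=
  exists_isRecursive_models_realExpExistentialTheory mwTheory_subset_realExpTheory
    (OEF_isRecursive.isREAxioms.union ExpPolyCode.newtonScheme_isREAxioms)
    fun _ hφ => mwTheory_models_of_mem_of_schanuelProperty hSC hφ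

/-- **What remains of `macintyre_wilkie`.** Macintyre–Wilkie's Theorem 1.1
(`SchanuelProperty ℝ → RealExpDecidable`) follows from its unconditional half alone — the
recursive subtheory `macintyreWilkie_recursiveSubtheory` (effective model completeness) — the
conditional half being now a theorem. [cite: MacintyreWilkieKreiseliana1996, Thm. 1.1] -/
theorem macintyre_wilkie_of_recursiveSubtheory_alone (hA : macintyreWilkie_recursiveSubtheory) :
    macintyre_wilkie :=
  macintyre_wilkie_of_recursiveSubtheory hA macintyreWilkie_existential_of_schanuelProperty_holds


/-! ### Corollaries first landed in p29307 (restored)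

The three declarations below were landed by the parallel unit
`…ExponentialFields-e92530df94-0` (proposal p29307) in an earlier version of this file and were
dropped by the whole-file proposal p28805, which had been prepared before p29307 existed; they are
restored here with the same names and statements. -/

/-- **Under the real Schanuel property, decidability of `Th(ℝ_exp)` is equivalent to
Macintyre–Wilkie's unconditional half** (the existence of a recursive `T₀ ⊆ Th(ℝ_exp)` with
`T₀ ∪ Th_∃(ℝ_exp) ⊨ Th(ℝ_exp)`): `→` because a decidable `Th(ℝ_exp)` is itself such a `T₀`,
`←` by `macintyre_wilkie_of_recursiveSubtheory_alone`. So, granted `SC_ℝ`, what is still missing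
for `RealExpDecidable` is exactly `macintyreWilkie_recursiveSubtheory`. [folklore] -/
theorem realExpDecidable_iff_recursiveSubtheory_of_schanuelProperty (hSC : SchanuelProperty ℝ) :
    RealExpDecidable ↔ macintyreWilkie_recursiveSubtheory :=
  ⟨fun h => ⟨realExpTheory, subset_rfl, realExpDecidable_iff_isRecursive.1 h, fun _ hφ =>
      Language.Theory.models_sentence_mono Set.subset_union_left
        (Language.Theory.models_sentence_of_mem hφ)⟩,
    fun hA => macintyre_wilkie_of_recursiveSubtheory_alone hA hSC⟩

/-- **Macintyre–Wilkie's Theorem 1.1 from the recursive subtheory** (same statement as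
`macintyre_wilkie_of_recursiveSubtheory_alone`; name kept from p29307). [cite: MacintyreWilkieKreiseliana1996, Thm. 1.1] -/
theorem macintyre_wilkie_of_recursiveSubtheory_holds (h : macintyreWilkie_recursiveSubtheory) :
    macintyre_wilkie :=
  macintyre_wilkie_of_recursiveSubtheory_alone h

/-- **Macintyre–Wilkie's Theorem 1.1 from a recursive model complete subtheory of `Th(ℝ_exp)`**
(what an effective version of Wilkie's theorem provides), the conditional half being discharged:
`macintyre_wilkie_of_recursive_modelComplete_subtheory` of `MacintyreWilkie.lean` with its last
hypothesis fed `macintyreWilkie_existential_of_schanuelProperty_holds`. [cite: MacintyreWilkieKreiseliana1996, Thm. 1.1] -/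
theorem macintyre_wilkie_of_recursive_modelComplete_subtheory'
    {T₀ : Language.orderedExpRing.Theory} (hT₀ : T₀ ⊆ realExpTheory) (hrec : T₀.IsRecursive)
    (hmc : T₀.IsModelComplete) : macintyre_wilkie :=
  macintyre_wilkie_of_recursive_modelComplete_subtheory hT₀ hrec hmc
    macintyreWilkie_existential_of_schanuelProperty_holds

end Literature.ModelTheory.ExponentialFields

end
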